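import Summits.BirchSwinnertonDyer.BirchSwinnertonDyer.Theorems.ManinLocalTwoThreeTwistDefectCuspCoeff

/-!
# THE DEFECT LAW OF THE TWIST GROUPOID, part 4 of 4: 71.H SQUEEZE TRANSPORT along an aligned twist, and LEVEL 128 classes `128b`, `128d` from p3's
squeeze for `φ₁₂₈ₐ` (cell bsd-f2-manin, desc g46 MEMO-desc §71 §7–§8, TURNKEY T-desc-58; landed by p1 gen 25)

§7: p3's Néron squeeze for `φ ⊗ χ` from the squeeze for `φ` along an ALIGNED twist (`abs_maninConstant_eq_one_of_squeeze_charTwist_aligned`,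
`…_of_squeeze_twoTwist_aligned`, `SqueezeTransportTwoTwist`, `squeezeTransportTwoTwist_oneTwentyEight`); §8: `128b1 = [0,1,0,3,−5]`, `128d1 = [0,−1,0,3,5]`
are ONE ALIGNED `±8`-edge from `128a1` (`smul_quadraticTwist_oneTwentyEightA1_negTwo/_two`, minimality and discriminants in the kernel) ⟹
`abs_maninConstant_eq_one_oneTwentyEightB_of_cuspCoeff` / `…D_of_cuspCoeff`: `|c| = 1` for every lattice-optimal `X₀(128)`-datum whose newform is the
`χ(∓8)`-twist of `φ₁₂₈ₐ` — modulo the coefficient identity only (no `η`-parametrisation of `y` on `128b/d` needed).  No named fact; C2, Manin's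
conjecture and BSD NOT proved.
[cite: Stevens1989, Lemma (5.2) p. 96, Lemma (5.4) p. 97, (5.6)–(5.7) p. 98] [cite: Pal2012, Prop. 2.4, Lemma 3.1]
[cite: Connell1999, §5.7.3] [cite: SilvermanAEC2009, Cor. VII.7.2, §C.16] [cite: SilvermanATAEC1994, Cor. IV.9.1] [cite: EdixhovenManin1991, Prop. 2]
-/

set_option autoImplicit false
-- the summit-side namespace `Summit.BirchSwinnertonDyer.BirchSwinnertonDyer.…` is the tree's (summit = sub-problem)
set_option linter.dupNamespace false

noncomputable section

open scoped Classical NumberField MatrixGroups ModularForm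

namespace Summit.BirchSwinnertonDyer.BirchSwinnertonDyer.Theorems.ManinLocalTwoThree.TwistDefect

open WeierstrassCurve CongruenceSubgroup IsDedekindDomain IsDedekindDomain.HeightOneSpectrum Rat.HeightOneSpectrum
  Literature.NumberTheory.Automorphic Literature.NumberTheory.EllipticCurves Literature.NumberTheory.EllipticCurves.ModularForms
  Literature.NumberTheory.LFunctions.PrimitiveQuadratic Summit.BirchSwinnertonDyer.BirchSwinnertonDyer.Theorems
  Summit.BirchSwinnertonDyer.BirchSwinnertonDyer.Theorems.ManinLocalTwoThree Summit.BirchSwinnertonDyer.Rank1Residual.ManinAdditive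
  Summit.BirchSwinnertonDyer.BirchSwinnertonDyer.Theorems.ManinLocalTwoThree.TwistFamilies
  Summit.BirchSwinnertonDyer.BirchSwinnertonDyer.Theorems.ManinLocalTwoThree.AdditiveTwistFamilies

/-! ## §7 71.H  SQUEEZE TRANSPORT ALONG AN ALIGNED TWIST — p3's Néron squeeze for `φ ⊗ χ` from the
squeeze for `φ` (E-desc-241).  No datum on the root, no isogeny, no local hypothesis, no EXO change.

p3's capstones have the shape `NeronSqueeze.abs_maninConstant_eq_one_of_periodLattice_le`: an explicit
globally minimal `W₀` with Néron pair `L₀` and the SQUEEZE `Λ(φ) ⊆ Λ(L₀)` give `|c(D)| = 1` for every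
lattice-optimal datum with `D.f = φ`.  For `128b/128d` the squeeze is what p3 cannot produce directly
("y not an η-quotient").  71.H: the squeeze for `φ₀` (root form, e.g. `φ₁₂₈a`) w.r.t. ANY elliptic `W₀`
with Néron pair `L₀`, the vanishing of the even coefficients of `φ₀`, an explicit ALIGNED minimal model
`C = u • (W₀ ⊗ d)` (`r = ±1`), and the odd-coefficient identity `aₙ(f_D) = χ_d(n)·aₙ(φ₀)` give
`|c(D)| = 1`: `z ∈ Λ(f_D) = Λ(φ₀ ⊗ χ) ⟹ s·z ∈ Λ(φ₀) ⊆ Λ(L₀) ⟹ z ∈ Λ_C` (Néron pair of the twist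
= `s⁻¹ r Λ(L₀)`), then p3's squeeze with root `C`. -/

/-- **71.H-core (generic even-killing quadratic character).** [cite: Stevens1989, Lemma (5.4) p. 97]
[cite: Pal2012, Lemma 3.1] [cite: AgasheRibetStein2006, §§1–2] -/
theorem abs_maninConstant_eq_one_of_squeeze_charTwist_aligned
    {N : ℕ} [NeZero N] (h4N : 4 ∣ N) {m : ℕ} [NeZero m] (hmN : m ^ 2 ∣ N)
    {χ : DirichletCharacter ℂ m} (hχq : χ.IsQuadratic) (hχp : χ.IsPrimitive) {d : ℤ} (hd : d ≠ 0)
    (hG : gaussSum χ (ZMod.stdAddChar (N := m)) ^ 2 = ((4 * d : ℤ) : ℂ))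
    (f₀ : CuspForm (Gamma0 N) 2)
    (hsumOf : (∀ x : ℚ, modularSymbol f₀ (x + 1 / 2) = -modularSymbol f₀ x) →
      ∀ x : ℚ, ∃ (u₁ u₂ : ZMod m) (ε : ℤ),
        ∑ v : ZMod m, χ v * modularSymbol f₀ (x + twistShift v) =
          2 * (modularSymbol f₀ (x + twistShift u₁) + ε * modularSymbol f₀ (x + twistShift u₂)))
    (hχeven : ∀ n : ℕ, 2 ∣ n → χ n = 0)
    (W₀ : WeierstrassCurve ℚ) [W₀.IsElliptic] (L₀ : PeriodPair) (hL₀ : IsNeronLatticeOf (W₀.baseChange ℂ) L₀)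
    (hS0 : ∀ z ∈ periodLattice f₀, z ∈ L₀.lattice)
    (heven : ∀ n : ℕ, 2 ∣ n → cuspCoeff f₀ n = 0)
    {C : WeierstrassCurve ℚ} [C.IsElliptic] [C.IsGloballyMinimal] (u : VariableChange ℚ)
    (hu : u • W₀.quadraticTwist (d : ℚ) = C) {r : ℤ} (hr : r = 1 ∨ r = -1)
    (hΔ : (r : ℚ) ^ 12 * C.Δ = (d : ℚ) ^ 6 * W₀.Δ)
    (W : WeierstrassCurve ℚ) [W.IsElliptic] [W.IsGloballyMinimal] (D : ModularParametrizationData W N)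
    (hf : ∀ n : ℕ, ¬ 2 ∣ n → cuspCoeff D.f n = χ n * cuspCoeff f₀ n)
    (hopt : ∀ z ∈ D.L.lattice, ∃ w ∈ periodLattice D.f, z = D.c * w) :
    |D.maninConstant| = 1 := by
  haveI : Fact (Nat.Prime 2) := ⟨Nat.prime_two⟩
  have hd0 : (d : ℚ) ≠ 0 := by exact_mod_cast hd
  haveI : (W₀.quadraticTwist (d : ℚ)).IsElliptic := W₀.isElliptic_quadraticTwist hd0
  set s : ℂ := gaussSum χ (ZMod.stdAddChar (N := m)) / 2 with hs
  have hs2 : s ^ 2 = ((d : ℚ) : ℂ) := by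
    rw [hs, div_pow, hG]
    push_cast
    ring
  -- HALF-TRANSLATE for the root form and the exact twist step `s · Λ(φ₀ ⊗ χ) ⊆ Λ(φ₀)` at level `N`
  have hhalf : ∀ x : ℚ, modularSymbol f₀ (x + 1 / 2) = -modularSymbol f₀ x :=
    maninLocalTwoThree_modularSymbol_add_half_eq_neg_of_four_dvd f₀ h4N heven
  have hstep : ∀ w ∈ periodLattice (charTwist N (dvd_refl N) hmN hχq f₀), s * w ∈ periodLattice f₀ :=
    fun w hw ↦ half_gaussSum_mul_mem_periodLattice_of_mem_charTwist N (dvd_refl N) hmN hχq hχp f₀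
      (hsumOf hhalf) hw
  -- `W` is additive at `2` (read off the level), so `f_D = φ₀ ⊗ χ` as forms of level `N`
  have hadd : ¬ W.HasGoodReductionAtPrime 2 ∧ ¬ W.HasMultiplicativeReductionAtPrime 2 :=
    KatoCurve.additive_of_sq_dvd_level 2 W D.f D.isNewformOf
      (by rw [show (2 : ℕ) ^ 2 = 4 by norm_num]; exact h4N)
  have hfD : D.f = charTwist N (dvd_refl N) hmN hχq f₀ :=
    eq_of_forall_cuspCoeff_eq_gamma0 fun n ↦ by
      rw [cuspCoeff_charTwist N (dvd_refl N) hmN hχq hχp]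
      by_cases h2n : 2 ∣ n
      · rw [D.isNewformOf.2 n, W.LFunction_apply_eq_zero_of_not_good_of_not_mult 2 hadd.1 hadd.2 h2n,
          hχeven n h2n]
        simp
      · exact hf n h2n
  -- the Néron pair of `C` and the transported squeeze `Λ(f_D) ⊆ Λ_C`
  obtain ⟨LC, hC⟩ := exists_isNeronLatticeOf_holds (C.baseChange ℂ)
  have hS2 : ∀ z ∈ periodLattice D.f, z ∈ LC.lattice := by
    intro z hz
    rw [hfD] at hz
    have h1 : s * z ∈ L₀.lattice := hS0 _ (hstep z hz)
    rcases hr with rfl | rfl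
    · rw [neronLattice_mem_iff_of_twist_of_sq_eq hd0 u hu hΔ hs2 hL₀ hC]
      convert h1 using 1
      push_cast
      ring
    · rw [neronLattice_mem_iff_of_twist_of_sq_eq hd0 u hu hΔ hs2 hL₀ hC]
      convert neg_mem h1 using 1
      push_cast
      ring
  exact NeronSqueeze.abs_maninConstant_eq_one_of_periodLattice_le C LC hC W D hS2 hopt

/-- **71.H  SQUEEZE TRANSPORT ALONG AN ALIGNED `±8`-TWIST.**  For `d = ±2`: the squeeze `Λ(φ₀) ⊆ Λ(L₀)`
for the root form `φ₀ ∈ S₂(Γ₀(N))` (`4 ∣ N`, `64 ∣ N`) w.r.t. any elliptic `W₀` with Néron pair `L₀`,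
`a₂ₖ(φ₀) = 0`, an explicit globally minimal `C = u • (W₀ ⊗ d)` with `r = ±1`, and
`aₙ(f_D) = χ_d(n)·aₙ(φ₀)` at odd `n` (`χ_2 = χ₈`, `χ_{-2} = χ₈'`) ⟹ `|c(D)| = 1` for every lattice-optimal
`X₀(N)`-datum `D` on every globally minimal `W`.  USE (level 128): `W₀ = [0,1,0,1,1]`, `L₀ = Λ(−8/3, −80/27)`,
`φ₀ = φ₁₂₈a`, `C = [0,1,0,3,−5]` (`d = −2`, `u = ⟨1,1,0,0⟩`) resp. `[0,−1,0,3,5]` (`d = 2`, `u = ⟨1,−1,0,0⟩`),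
`r = 1` (desc `Orientation128-desc-g46.lean`: `edge_a_b`, `edge_a_d`, `aligned_edges`) ⟹ 128b, 128d.
[cite: Stevens1989, Lemma (5.4) p. 97] [cite: Pal2012, Prop. 2.4, Lemma 3.1] [cite: AgasheRibetStein2006, §§1–2] -/
theorem abs_maninConstant_eq_one_of_squeeze_twoTwist_aligned {d : ℤ} (hd : d = 2 ∨ d = -2)
    {N : ℕ} [NeZero N] (h4N : 4 ∣ N) (h64N : 8 ^ 2 ∣ N)
    (f₀ : CuspForm (Gamma0 N) 2)
    (W₀ : WeierstrassCurve ℚ) [W₀.IsElliptic] (L₀ : PeriodPair) (hL₀ : IsNeronLatticeOf (W₀.baseChange ℂ) L₀)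
    (hS0 : ∀ z ∈ periodLattice f₀, z ∈ L₀.lattice)
    (heven : ∀ n : ℕ, 2 ∣ n → cuspCoeff f₀ n = 0)
    {C : WeierstrassCurve ℚ} [C.IsElliptic] [C.IsGloballyMinimal] (u : VariableChange ℚ)
    (hu : u • W₀.quadraticTwist (d : ℚ) = C) {r : ℤ} (hr : r = 1 ∨ r = -1)
    (hΔ : (r : ℚ) ^ 12 * C.Δ = (d : ℚ) ^ 6 * W₀.Δ)
    (W : WeierstrassCurve ℚ) [W.IsElliptic] [W.IsGloballyMinimal] (D : ModularParametrizationData W N)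
    (hf : ∀ n : ℕ, ¬ 2 ∣ n →
      cuspCoeff D.f n = ((if d = 2 then ZMod.χ₈ n else ZMod.χ₈' n : ℤ) : ℂ) * cuspCoeff f₀ n)
    (hopt : ∀ z ∈ D.L.lattice, ∃ w ∈ periodLattice D.f, z = D.c * w) :
    |D.maninConstant| = 1 := by
  have hdZ : d ≠ 0 := by rcases hd with rfl | rfl <;> norm_num
  rcases hd with rfl | rfl
  · exact abs_maninConstant_eq_one_of_squeeze_charTwist_aligned h4N h64N
      isQuadratic_χ₈_ringHomComp isPrimitive_χ₈_ringHomComp hdZ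
      (by rw [gaussSum_χ₈_ringHomComp_sq]; norm_num) f₀
      (fun hhalf x ↦ ⟨1, 3, -1, sum_χ₈_modularSymbol_of_half f₀ hhalf x⟩)
      (fun n hn ↦ by
        rw [χ₈_ringHomComp_apply_natCast, ZMod.χ₈_nat_eq_if_mod_eight,
          if_pos (Nat.mod_eq_zero_of_dvd hn)]
        simp)
      W₀ L₀ hL₀ hS0 heven u hu hr hΔ W D
      (fun n hn ↦ by rw [χ₈_ringHomComp_apply_natCast, hf n hn, if_pos rfl]) hopt
  · exact abs_maninConstant_eq_one_of_squeeze_charTwist_aligned h4N h64N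
      isQuadratic_χ₈'_ringHomComp isPrimitive_χ₈'_ringHomComp hdZ
      (by rw [gaussSum_χ₈'_ringHomComp_sq]; norm_num) f₀
      (fun hhalf x ↦ ⟨1, 3, 1, sum_χ₈'_modularSymbol_of_half f₀ hhalf x⟩)
      (fun n hn ↦ by
        rw [χ₈'_ringHomComp_apply_natCast, ZMod.χ₈'_nat_eq_if_mod_eight,
          if_pos (Nat.mod_eq_zero_of_dvd hn)]
        simp)
      W₀ L₀ hL₀ hS0 heven u hu hr hΔ W D
      (fun n hn ↦ by rw [χ₈'_ringHomComp_apply_natCast, hf n hn, if_neg (by norm_num)]) hopt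

/-- **E-desc-241 (typed candidate Prop): SQUEEZE TRANSPORT at level `N` for `d = ±2`.**  A THEOREM for
every `N` with `4 ∣ N`, `64 ∣ N` (`squeezeTransportTwoTwist_of`), in particular `N = 128`. -/
def SqueezeTransportTwoTwist (N : ℕ) [NeZero N] (d : ℤ) : Prop :=
  ∀ (f₀ : CuspForm (Gamma0 N) 2) (W₀ : WeierstrassCurve ℚ) [W₀.IsElliptic] (L₀ : PeriodPair),
    IsNeronLatticeOf (W₀.baseChange ℂ) L₀ → (∀ z ∈ periodLattice f₀, z ∈ L₀.lattice) →
    (∀ n : ℕ, 2 ∣ n → cuspCoeff f₀ n = 0) →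
    ∀ (C : WeierstrassCurve ℚ) [C.IsElliptic] [C.IsGloballyMinimal] (u : VariableChange ℚ) (r : ℤ),
      u • W₀.quadraticTwist (d : ℚ) = C → (r = 1 ∨ r = -1) → (r : ℚ) ^ 12 * C.Δ = (d : ℚ) ^ 6 * W₀.Δ →
      ∀ (W : WeierstrassCurve ℚ) [W.IsElliptic] [W.IsGloballyMinimal] (D : ModularParametrizationData W N),
        (∀ n : ℕ, ¬ 2 ∣ n →
          cuspCoeff D.f n = ((if d = 2 then ZMod.χ₈ n else ZMod.χ₈' n : ℤ) : ℂ) * cuspCoeff f₀ n) →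
        (∀ z ∈ D.L.lattice, ∃ w ∈ periodLattice D.f, z = D.c * w) → |D.maninConstant| = 1

/-- The squeeze-transport law `SqueezeTransportTwoTwist N d` from `4 ∣ N`, `8² ∣ N` (71.H specialised). [cite: Stevens1989, Lemma (5.4) p. 97] -/
theorem squeezeTransportTwoTwist_of {N : ℕ} [NeZero N] (h4N : 4 ∣ N) (h64N : 8 ^ 2 ∣ N) {d : ℤ}
    (hd : d = 2 ∨ d = -2) : SqueezeTransportTwoTwist N d :=
  fun f₀ W₀ _ L₀ hL₀ hS0 heven _C _ _ u _r hu hr hΔ W _ _ D hf hopt ↦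
    abs_maninConstant_eq_one_of_squeeze_twoTwist_aligned hd h4N h64N f₀ W₀ L₀ hL₀ hS0 heven u hu hr hΔ W D
      hf hopt

/-- **E-desc-241 at level 128** (the 128b/128d use): `4 ∣ 128`, `8² ∣ 128`. -/
theorem squeezeTransportTwoTwist_oneTwentyEight {d : ℤ} (hd : d = 2 ∨ d = -2) :
    SqueezeTransportTwoTwist 128 d :=
  squeezeTransportTwoTwist_of ⟨32, rfl⟩ ⟨2, rfl⟩ hd


/-! ## §8 LEVEL 128: the classes `128b`, `128d` from p3's squeeze for `φ₁₂₈a` (71.H instantiated)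

Inputs left symbolic (the LEAD's): the root form `φa` with p3's
`EtaIdentitiesOneTwentyEightA.periodLatticeLe_oneTwentyEight φa hφa` (its literal conclusion is the
hypothesis `hLa`), the vanishing of its even coefficients `heven`, and the odd-coefficient identity `hf`
(`φ₁₂₈b = φ₁₂₈a ⊗ χ₈'`, `φ₁₂₈d = φ₁₂₈a ⊗ χ₈` — finitely many coefficients in p3's `LevelForms` basis,
`charTwist 128 _ _ _ φa ∈ S₂(Γ₀(128))` by construction).  Everything about the CURVES is proved here:
the aligned edges `128a1 ⊗ (−2) = 128b1`, `128a1 ⊗ 2 = 128d1` (`u = 1`, `r = 1`), the minimality of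
`128b1 = [0,1,0,3,−5]` and `128d1 = [0,−1,0,3,5]` (Kraus at `2`: `(v₂c₄, v₂c₆, v₂Δ) = (7, 10, 14)`,
`2⁸ ∤ c₄`, `2⁸ ∤ c₆ + 2⁶`), their discriminants. -/

open Literature.NumberTheory.EllipticCurves.Rank1Residual.X11RankOneCertificates (discOf c4Of c6Of)

/-- `Δ, c₄, c₆` of `128b1 = [0,1,0,3,−5]`: `−2¹⁴, −2⁷, 2¹⁰·5` (kernel evaluation). [folklore] -/
theorem invariants_oneTwentyEightB1 :
    discOf [0, 1, 0, 3, -5] = -16384 ∧ c4Of [0, 1, 0, 3, -5] = -128 ∧ c6Of [0, 1, 0, 3, -5] = 5120 := by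
  refine ⟨?_, ?_, ?_⟩ <;> decide

/-- `Δ, c₄, c₆` of `128d1 = [0,−1,0,3,5]`: `−2¹⁴, −2⁷, −2¹⁰·5` (kernel evaluation). [folklore] -/
theorem invariants_oneTwentyEightD1 :
    discOf [0, -1, 0, 3, 5] = -16384 ∧ c4Of [0, -1, 0, 3, 5] = -128 ∧ c6Of [0, -1, 0, 3, 5] = -5120 := by
  refine ⟨?_, ?_, ?_⟩ <;> decide

/-- **`128b1 = [0,1,0,3,−5]` is a global minimal model** (Kraus at `2`; `q¹² ∤ 2¹⁴` for odd `q`).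
[cite: Kraus1989, Prop. 2] [cite: SilvermanAEC2009, VII.1 Remark 1.1] -/
theorem isGloballyMinimal_oneTwentyEightB1_cast :
    (⟨((0 : ℤ) : ℚ), ((1 : ℤ) : ℚ), ((0 : ℤ) : ℚ), ((3 : ℤ) : ℚ), ((-5 : ℤ) : ℚ)⟩ :
      WeierstrassCurve ℚ).IsGloballyMinimal := by
  obtain ⟨hD, hc4, hc6⟩ := invariants_oneTwentyEightB1
  refine WeierstrassCurve.isGloballyMinimal_of_int_kraus 0 1 0 3 (-5) fun q hq ↦ ?_
  rcases eq_or_ne q 2 with rfl | h2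
  · refine Or.inr (Or.inl ⟨rfl, ?_, ?_, ?_⟩)
    · rw [hD]; norm_num
    · rw [hc4]; norm_num
    · rw [hc6]; norm_num
  · refine Or.inl fun h ↦ ?_
    obtain ⟨h12, -⟩ := h
    rw [hD] at h12
    have hq1 : (q : ℤ) ∣ 16384 := dvd_neg.mp (dvd_trans (dvd_pow_self _ (by norm_num)) h12)
    have hdvdN : q ∣ 2 ^ 14 := by
      have e : ((2 ^ 14 : ℕ) : ℤ) = 16384 := by norm_num
      exact Int.natCast_dvd_natCast.mp (e ▸ hq1)
    exact h2 ((Nat.prime_dvd_prime_iff_eq hq Nat.prime_two).mp ((Nat.Prime.prime hq).dvd_of_dvd_pow hdvdN))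

/-- **`128d1 = [0,−1,0,3,5]` is a global minimal model.** [cite: Kraus1989, Prop. 2] [cite: SilvermanAEC2009, VII.1 Remark 1.1] -/
theorem isGloballyMinimal_oneTwentyEightD1_cast :
    (⟨((0 : ℤ) : ℚ), ((-1 : ℤ) : ℚ), ((0 : ℤ) : ℚ), ((3 : ℤ) : ℚ), ((5 : ℤ) : ℚ)⟩ :
      WeierstrassCurve ℚ).IsGloballyMinimal := by
  obtain ⟨hD, hc4, hc6⟩ := invariants_oneTwentyEightD1
  refine WeierstrassCurve.isGloballyMinimal_of_int_kraus 0 (-1) 0 3 5 fun q hq ↦ ?_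
  rcases eq_or_ne q 2 with rfl | h2
  · refine Or.inr (Or.inl ⟨rfl, ?_, ?_, ?_⟩)
    · rw [hD]; norm_num
    · rw [hc4]; norm_num
    · rw [hc6]; norm_num
  · refine Or.inl fun h ↦ ?_
    obtain ⟨h12, -⟩ := h
    rw [hD] at h12
    have hq1 : (q : ℤ) ∣ 16384 := dvd_neg.mp (dvd_trans (dvd_pow_self _ (by norm_num)) h12)
    have hdvdN : q ∣ 2 ^ 14 := by
      have e : ((2 ^ 14 : ℕ) : ℤ) = 16384 := by norm_num
      exact Int.natCast_dvd_natCast.mp (e ▸ hq1)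
    exact h2 ((Nat.prime_dvd_prime_iff_eq hq Nat.prime_two).mp ((Nat.Prime.prime hq).dvd_of_dvd_pow hdvdN))

/-- `128b1 = [0, 1, 0, 3, −5]` is globally minimal (Kraus at every prime, kernel). [cite: Cremona1997, §3.2] -/
theorem isGloballyMinimal_oneTwentyEightB1 : (⟨0, 1, 0, 3, -5⟩ : WeierstrassCurve ℚ).IsGloballyMinimal := by
  rw [show (⟨0, 1, 0, 3, -5⟩ : WeierstrassCurve ℚ) =
      ⟨((0 : ℤ) : ℚ), ((1 : ℤ) : ℚ), ((0 : ℤ) : ℚ), ((3 : ℤ) : ℚ), ((-5 : ℤ) : ℚ)⟩ by ext <;> norm_num]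
  exact isGloballyMinimal_oneTwentyEightB1_cast

/-- `128d1 = [0, −1, 0, 3, 5]` is globally minimal (Kraus at every prime, kernel). [cite: Cremona1997, §3.2] -/
theorem isGloballyMinimal_oneTwentyEightD1 : (⟨0, -1, 0, 3, 5⟩ : WeierstrassCurve ℚ).IsGloballyMinimal := by
  rw [show (⟨0, -1, 0, 3, 5⟩ : WeierstrassCurve ℚ) =
      ⟨((0 : ℤ) : ℚ), ((-1 : ℤ) : ℚ), ((0 : ℤ) : ℚ), ((3 : ℤ) : ℚ), ((5 : ℤ) : ℚ)⟩ by ext <;> norm_num]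
  exact isGloballyMinimal_oneTwentyEightD1_cast

/-- `128b1` is elliptic (`Δ ≠ 0`). [folklore] -/
theorem isElliptic_oneTwentyEightB1 : (⟨0, 1, 0, 3, -5⟩ : WeierstrassCurve ℚ).IsElliptic :=
  ⟨by norm_num [WeierstrassCurve.Δ, WeierstrassCurve.b₂, WeierstrassCurve.b₄, WeierstrassCurve.b₆,
    WeierstrassCurve.b₈]⟩

/-- `128d1` is elliptic (`Δ ≠ 0`). [folklore] -/
theorem isElliptic_oneTwentyEightD1 : (⟨0, -1, 0, 3, 5⟩ : WeierstrassCurve ℚ).IsElliptic :=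
  ⟨by norm_num [WeierstrassCurve.Δ, WeierstrassCurve.b₂, WeierstrassCurve.b₄, WeierstrassCurve.b₆,
    WeierstrassCurve.b₈]⟩

/-- **ALIGNED EDGE `128a1 ⊗ (−2) = 128b1`**: `⟨1, 1, 0, 0⟩ • ([0,1,0,1,1] ⊗ (−2)) = [0,1,0,3,−5]`. [folklore] -/
theorem smul_quadraticTwist_oneTwentyEightA1_negTwo :
    (⟨1, 1, 0, 0⟩ : VariableChange ℚ) • (⟨0, 1, 0, 1, 1⟩ : WeierstrassCurve ℚ).quadraticTwist (((-2 : ℤ)) : ℚ) =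
      ⟨0, 1, 0, 3, -5⟩ := by
  ext <;> simp only [variableChange_a₁, variableChange_a₂, variableChange_a₃, variableChange_a₄,
    variableChange_a₆, quadraticTwist_a₁, quadraticTwist_a₂, quadraticTwist_a₃, quadraticTwist_a₄,
    quadraticTwist_a₆, b₂, b₄, b₆, inv_one, Units.val_one] <;> norm_num

/-- **ALIGNED EDGE `128a1 ⊗ 2 = 128d1`**: `⟨1, −1, 0, 0⟩ • ([0,1,0,1,1] ⊗ 2) = [0,−1,0,3,5]`. [folklore] -/
theorem smul_quadraticTwist_oneTwentyEightA1_two :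
    (⟨1, -1, 0, 0⟩ : VariableChange ℚ) • (⟨0, 1, 0, 1, 1⟩ : WeierstrassCurve ℚ).quadraticTwist (((2 : ℤ)) : ℚ) =
      ⟨0, -1, 0, 3, 5⟩ := by
  ext <;> simp only [variableChange_a₁, variableChange_a₂, variableChange_a₃, variableChange_a₄,
    variableChange_a₆, quadraticTwist_a₁, quadraticTwist_a₂, quadraticTwist_a₃, quadraticTwist_a₄,
    quadraticTwist_a₆, b₂, b₄, b₆, inv_one, Units.val_one] <;> norm_num

/-- `Δ(128b1) = (−2)⁶ · Δ(128a1)` (defect `r = 1`: the edge is ALIGNED). [folklore] -/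
theorem Δ_oneTwentyEightB1_eq :
    (((1 : ℤ)) : ℚ) ^ 12 * (⟨0, 1, 0, 3, -5⟩ : WeierstrassCurve ℚ).Δ =
      (((-2 : ℤ)) : ℚ) ^ 6 * (⟨0, 1, 0, 1, 1⟩ : WeierstrassCurve ℚ).Δ := by
  norm_num [WeierstrassCurve.Δ, WeierstrassCurve.b₂, WeierstrassCurve.b₄, WeierstrassCurve.b₆,
    WeierstrassCurve.b₈]

/-- `Δ(128d1) = 2⁶ · Δ(128a1)` (defect `r = 1`). [folklore] -/
theorem Δ_oneTwentyEightD1_eq :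
    (((1 : ℤ)) : ℚ) ^ 12 * (⟨0, -1, 0, 3, 5⟩ : WeierstrassCurve ℚ).Δ =
      (((2 : ℤ)) : ℚ) ^ 6 * (⟨0, 1, 0, 1, 1⟩ : WeierstrassCurve ℚ).Δ := by
  norm_num [WeierstrassCurve.Δ, WeierstrassCurve.b₂, WeierstrassCurve.b₄, WeierstrassCurve.b₆,
    WeierstrassCurve.b₈]

/-- **128b (X-desc-g46c).**  `|c(D)| = 1` for every lattice-optimal `X₀(128)`-datum `D` on every
globally minimal `W` whose newform is the `χ₈'`-twist of `φ₁₂₈a` on odd coefficients — given p3's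
squeeze for `φ₁₂₈a` (`hLa` = the conclusion of `EtaIdentitiesOneTwentyEightA.periodLatticeLe_oneTwentyEight
φa hφa`) and the vanishing of the even coefficients of `φ₁₂₈a`.  No parametrisation of `128b` is used.
[cite: AgasheRibetStein2006, §§1–2] [cite: Stevens1989, Lemma (5.4) p. 97] -/
theorem abs_maninConstant_eq_one_oneTwentyEightB_of_cuspCoeff (φa : CuspForm (Gamma0 128) 2)
    (hLa : ∃ L₁ : PeriodPair, L₁.g₂ = -8 / 3 ∧ L₁.g₃ = -80 / 27 ∧ ∀ z ∈ periodLattice φa, z ∈ L₁.lattice)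
    (heven : ∀ n : ℕ, 2 ∣ n → cuspCoeff φa n = 0)
    (W : WeierstrassCurve ℚ) [W.IsElliptic] [W.IsGloballyMinimal] (D : ModularParametrizationData W 128)
    (hf : ∀ n : ℕ, ¬ 2 ∣ n → cuspCoeff D.f n = (ZMod.χ₈' n : ℂ) * cuspCoeff φa n)
    (hopt : ∀ z ∈ D.L.lattice, ∃ w ∈ periodLattice D.f, z = D.c * w) :
    |D.maninConstant| = 1 := by
  obtain ⟨L₀, hg2, hg3, hS0⟩ := hLa
  haveI := NeronSqueezeOneTwentyEightA.isElliptic_oneTwentyEightA1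
  haveI := isElliptic_oneTwentyEightB1
  haveI := isGloballyMinimal_oneTwentyEightB1
  exact abs_maninConstant_eq_one_of_squeeze_twoTwist_aligned (d := -2) (Or.inr rfl) ⟨32, rfl⟩ ⟨2, rfl⟩ φa
    ⟨0, 1, 0, 1, 1⟩ L₀ (NeronSqueezeOneTwentyEightA.isNeronLatticeOf_oneTwentyEightA1 hg2 hg3) hS0 heven
    (C := ⟨0, 1, 0, 3, -5⟩) ⟨1, 1, 0, 0⟩ smul_quadraticTwist_oneTwentyEightA1_negTwo (r := 1) (Or.inl rfl)
    Δ_oneTwentyEightB1_eq W D (fun n hn ↦ by rw [hf n hn, if_neg (by norm_num)]) hopt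

/-- **128d (X-desc-g46c).**  The same with `χ₈` (`φ₁₂₈d = φ₁₂₈a ⊗ χ₈` on odd coefficients) and `128d1 = [0,−1,0,3,5]`.
[cite: AgasheRibetStein2006, §§1–2] [cite: Stevens1989, Lemma (5.4) p. 97] -/
theorem abs_maninConstant_eq_one_oneTwentyEightD_of_cuspCoeff (φa : CuspForm (Gamma0 128) 2)
    (hLa : ∃ L₁ : PeriodPair, L₁.g₂ = -8 / 3 ∧ L₁.g₃ = -80 / 27 ∧ ∀ z ∈ periodLattice φa, z ∈ L₁.lattice)
    (heven : ∀ n : ℕ, 2 ∣ n → cuspCoeff φa n = 0)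
    (W : WeierstrassCurve ℚ) [W.IsElliptic] [W.IsGloballyMinimal] (D : ModularParametrizationData W 128)
    (hf : ∀ n : ℕ, ¬ 2 ∣ n → cuspCoeff D.f n = (ZMod.χ₈ n : ℂ) * cuspCoeff φa n)
    (hopt : ∀ z ∈ D.L.lattice, ∃ w ∈ periodLattice D.f, z = D.c * w) :
    |D.maninConstant| = 1 := by
  obtain ⟨L₀, hg2, hg3, hS0⟩ := hLa
  haveI := NeronSqueezeOneTwentyEightA.isElliptic_oneTwentyEightA1
  haveI := isElliptic_oneTwentyEightD1
  haveI := isGloballyMinimal_oneTwentyEightD1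
  exact abs_maninConstant_eq_one_of_squeeze_twoTwist_aligned (d := 2) (Or.inl rfl) ⟨32, rfl⟩ ⟨2, rfl⟩ φa
    ⟨0, 1, 0, 1, 1⟩ L₀ (NeronSqueezeOneTwentyEightA.isNeronLatticeOf_oneTwentyEightA1 hg2 hg3) hS0 heven
    (C := ⟨0, -1, 0, 3, 5⟩) ⟨1, -1, 0, 0⟩ smul_quadraticTwist_oneTwentyEightA1_two (r := 1) (Or.inl rfl)
    Δ_oneTwentyEightD1_eq W D (fun n hn ↦ by rw [hf n hn, if_pos rfl]) hopt

/-- `2 ∤ c` and `3 ∤ c` on `128b` and `128d` in the same situation (the route's C2/C3 conclusions there). -/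
theorem not_dvd_maninConstant_oneTwentyEightBD_of_cuspCoeff (φa : CuspForm (Gamma0 128) 2)
    (hLa : ∃ L₁ : PeriodPair, L₁.g₂ = -8 / 3 ∧ L₁.g₃ = -80 / 27 ∧ ∀ z ∈ periodLattice φa, z ∈ L₁.lattice)
    (heven : ∀ n : ℕ, 2 ∣ n → cuspCoeff φa n = 0)
    (W : WeierstrassCurve ℚ) [W.IsElliptic] [W.IsGloballyMinimal] (D : ModularParametrizationData W 128)
    (hf : (∀ n : ℕ, ¬ 2 ∣ n → cuspCoeff D.f n = (ZMod.χ₈' n : ℂ) * cuspCoeff φa n) ∨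
      (∀ n : ℕ, ¬ 2 ∣ n → cuspCoeff D.f n = (ZMod.χ₈ n : ℂ) * cuspCoeff φa n))
    (hopt : ∀ z ∈ D.L.lattice, ∃ w ∈ periodLattice D.f, z = D.c * w) :
    ¬ (2 : ℤ) ∣ D.maninConstant ∧ ¬ (3 : ℤ) ∣ D.maninConstant := by
  have h : |D.maninConstant| = 1 := by
    rcases hf with hf | hf
    · exact abs_maninConstant_eq_one_oneTwentyEightB_of_cuspCoeff φa hLa heven W D hf hopt
    · exact abs_maninConstant_eq_one_oneTwentyEightD_of_cuspCoeff φa hLa heven W D hf hopt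
  refine ⟨fun h2 ↦ ?_, fun h3 ↦ ?_⟩
  · have := Int.le_of_dvd (by rw [h]; norm_num) ((dvd_abs _ _).mpr h2)
    rw [h] at this
    norm_num at this
  · have := Int.le_of_dvd (by rw [h]; norm_num) ((dvd_abs _ _).mpr h3)
    rw [h] at this
    norm_num at this


end Summit.BirchSwinnertonDyer.BirchSwinnertonDyer.Theorems.ManinLocalTwoThree.TwistDefect

end
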